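import Summits.MatrixMultiplication.MatrixMultiplication.Theorems.LevelOneGL2Designs.Negative.Rectangle

/-!
# Negative lemmas for the crux `LevelOneGL2Designs` (stmt-MatrixMultiplication-14080), part R2:
translated rectangles — the master form of the rectangle kill, and rectangles in the middle

Refuter-side (cdisprove) analysis; no theorem asserts a Theses statement positively.
* `rectangle_orth_transl` — bi-invariance of `F_1` (part L) moves part R's rectangle relation
  anywhere: `g ↦ rectangle(a g b)` is orthogonal to every level-one test function.
* `not_rankSep_of_translated_rectangle` — MASTER FORM: if a two-sided translate of the rectangle
  `{1,a'} × {1,d'}` of `U⁺`-cosets lies inside the quadruple products `P = X⁻¹YY⁻¹Z` with its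
  corner ON a target `x₀⁻¹z₀` (`a x₀⁻¹ z₀ b = 1`), the triple is NOT rank-1-separated.
* `not_rankSep_of_middle_rectangle` — rectangles realised by the MIDDLE quotient set: `1 ∈ X ∩ Z`
  and `Q(Y) ⊇ {[[s,x],[0,t]] : x ∈ 𝔽_p, (s,t) ∈ {1,a'}×{1,d'}}` ⇒ NOT rank-1-separated; every
  Borel-type middle subgroup `U⁺⋊C` with a torus `C ∋ diag(a',1), diag(1,d')` (i.e. `C` not the
  graph of a homomorphism between the coordinates) is dead whatever the outer pieces — with parts
  P2 and R this leaves, among subgroup triples containing a Borel-type piece, only 'graph' tori.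
-/

noncomputable section

namespace Summit.MatrixMultiplication.MatrixMultiplication.Theorems.LevelOneGL2Designs.Negative

open Summit.MatrixMultiplication.MatrixMultiplication.Theorems.LieRankDesigns.Negative

variable {p : ℕ} [Fact p.Prime]

/-- **Translated relations.**  Bi-invariance of `F_1` moves the rectangle anywhere: for all
`a, b ∈ GL_2(𝔽_p)`, `g ↦ rectangle(a g b)` is again orthogonal to every level-one test function. -/
theorem rectangle_orth_transl {a₀ a' d₀ d' : ZMod p} (ha : a₀ ≠ 0) (ha' : a' ≠ 0) (hd : d₀ ≠ 0)
    (hd' : d' ≠ 0) (a b : GLm p 2) :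
    ∀ c : Mat p 2 → ℂ, RankSupp 1 c →
      ∑ g : GLm p 2, rectangle a₀ a' d₀ d' (a * g * b) * fourierFn c g = 0 := by
  classical
  intro c hc
  -- reindex g ↦ a g b
  have hre : ∑ g : GLm p 2, rectangle a₀ a' d₀ d' (a * g * b) * fourierFn c g
      = ∑ h : GLm p 2, rectangle a₀ a' d₀ d' h * fourierFn c (a⁻¹ * h * b⁻¹) := by
    refine Fintype.sum_equiv ((Equiv.mulLeft a).trans (Equiv.mulRight b)) _ _ fun g => ?_
    simp only [Equiv.trans_apply, Equiv.coe_mulLeft, Equiv.coe_mulRight]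
    congr 2
    group
  rw [hre]
  have h := rectangle_orth ha ha' hd hd' (transl b⁻¹ a⁻¹ c) (rankSupp_transl _ _ hc)
  simpa only [fourierFn_transl] using h

/-- **MASTER FORM OF THE RECTANGLE KILL.**  If some two-sided translate of the rectangle
`{1,a'} × {1,d'}` of `U⁺`-cosets lies inside the quadruple products `P = X⁻¹YY⁻¹Z` with its corner
ON a target `x₀⁻¹z₀` (i.e. `a x₀⁻¹ z₀ b = 1`), the triple is NOT rank-1-separated.  Specialisations:
the outer-piece template kill above (`a = b = 1`, target `1`), rectangles inside the MIDDLE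
(`Q(Y) ⊇ C·U⁺` with `C ≤ T` containing `diag(a',1)` and `diag(1,d')` — every non-'graph' torus
subgroup — and `1 ∈ X ∩ Z`), and rectangles around any other target. -/
theorem not_rankSep_of_translated_rectangle {X Y Z : Finset (GLm p 2)} {a' d' : ZMod p}
    (ha'0 : a' ≠ 0) (ha'1 : a' ≠ 1) (hd'0 : d' ≠ 0) (hd'1 : d' ≠ 1)
    {x₀ z₀ : GLm p 2} (hx₀ : x₀ ∈ X) (hz₀ : z₀ ∈ Z) (a b : GLm p 2)
    (htarget : a * (x₀⁻¹ * z₀) * b = 1)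
    (hP : ∀ g : GLm p 2, rectangle 1 a' 1 d' (a * g * b) ≠ 0 → g ∈ quadProducts X Y Z) :
    ¬ RankSep 1 X Y Z := by
  classical
  intro hsep
  obtain ⟨c, hc, hsepc⟩ := hsep x₀ hx₀ z₀ hz₀
  have hsum := rectangle_orth_transl one_ne_zero ha'0 one_ne_zero hd'0 a b c hc
  have hval : ∀ g : GLm p 2, rectangle 1 a' 1 d' (a * g * b) * fourierFn c g
      = if g = x₀⁻¹ * z₀ then rectangle 1 a' 1 d' (a * g * b) else 0 := by
    intro g
    by_cases hρ : rectangle 1 a' 1 d' (a * g * b) = 0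
    · simp [hρ]
    · rw [sep_apply_of_mem_quadProducts hx₀ hz₀ hsepc (hP g hρ)]
      by_cases hg1 : g = x₀⁻¹ * z₀ <;> simp [hg1]
  simp_rw [hval] at hsum
  rw [Finset.sum_ite_eq'] at hsum
  simp only [Finset.mem_univ, if_true, htarget] at hsum
  apply one_ne_zero (α := ℂ)
  rw [← hsum]
  unfold rectangle
  have e10 : ((1 : GLm p 2) : Mat p 2) 1 0 = 0 := by simp
  have e00 : ((1 : GLm p 2) : Mat p 2) 0 0 = 1 := by simp
  have e11 : ((1 : GLm p 2) : Mat p 2) 1 1 = 1 := by simp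
  rw [e10, e00, e11]
  simp [Ne.symm ha'1, Ne.symm hd'1]

/-- **RECTANGLE IN THE MIDDLE.**  If `1 ∈ X`, `1 ∈ Z` and the quotient set of the middle realises
the four cosets — for every `x : 𝔽_p` and each `(s,t) ∈ {1,a'}×{1,d'}` some `y, y' ∈ Y` have
`y y'⁻¹ = [[s, x],[0, t]]` — then `(X, Y, Z)` is NOT rank-1-separated.  (Every middle SUBGROUP
`H₂ ⊇ U⁺⋊C` with `C ∋ diag(a',1), diag(1,d')`, e.g. any torus subgroup `C ≤ T` that is not the graph
of a homomorphism between the two coordinates, whatever the outer pieces.) -/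
theorem not_rankSep_of_middle_rectangle {X Y Z : Finset (GLm p 2)} {a' d' : ZMod p}
    (ha'0 : a' ≠ 0) (ha'1 : a' ≠ 1) (hd'0 : d' ≠ 0) (hd'1 : d' ≠ 1)
    (h1X : (1 : GLm p 2) ∈ X) (h1Z : (1 : GLm p 2) ∈ Z)
    (hQ : ∀ (s t : ZMod p) (hs : s ≠ 0) (ht : t ≠ 0), (s = 1 ∨ s = a') → (t = 1 ∨ t = d') →
      ∀ x : ZMod p, ∃ y ∈ Y, ∃ y' ∈ Y, y * y'⁻¹ = triGL s t x hs ht) :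
    ¬ RankSep 1 X Y Z := by
  classical
  refine not_rankSep_of_translated_rectangle ha'0 ha'1 hd'0 hd'1 h1X h1Z 1 1 (by group) ?_
  intro g hg
  rw [one_mul, mul_one] at hg
  obtain ⟨h10, h00, h11⟩ := rectangle_support hg
  set s := (g : Mat p 2) 0 0 with hs
  set t := (g : Mat p 2) 1 1 with ht
  have hs0 : s ≠ 0 := by rcases h00 with h | h <;> rw [h] <;> [exact one_ne_zero; exact ha'0]
  have ht0 : t ≠ 0 := by rcases h11 with h | h <;> rw [h] <;> [exact one_ne_zero; exact hd'0]
  obtain ⟨y, hy, y', hy', hyy⟩ := hQ s t hs0 ht0 h00 h11 ((g : Mat p 2) 0 1)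
  have hg_eq : g = (1 : GLm p 2)⁻¹ * y * y'⁻¹ * 1 := by
    rw [inv_one, one_mul, mul_one, hyy]
    apply Units.ext
    rw [triGL_val]
    ext i j
    fin_cases i <;> fin_cases j
    · simp [hs]
    · rfl
    · simp [h10]
    · simp [ht]
  rw [hg_eq]
  exact mem_quadProducts h1X hy hy' h1Z


end Summit.MatrixMultiplication.MatrixMultiplication.Theorems.LevelOneGL2Designs.Negative

end
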